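import Summits.CriticalPhenomena.PercolationContinuityZ3.Theorems.PercNearOneGluingNoHeavyLowerTailDCInductionShellAll
import HarnessLib

/-!
# `NoHeavyLowerTail` (stmt-CriticalPhenomena-4575) — SHARP-ANY: the single-PAIR law of the (DC) induction on all fractional pairs

Support file (prover `prim-hp-3`, hull-port line; `--supports stmt-CriticalPhenomena-4575`).  No definitions, no named facts, no sorries.

Setting and notation as in `…DCInductionShell.lean` / `…DCInductionShellAll.lean`.  For a relay `v` outside the ports and ANY pair `f` with
`w f ∈ (0,1)` — a star pair or a pair of the base graph `K` — write `w₀ = w[f↦0]`, `w₁ = w[f↦1]`, `c = w f`; both are again two-pendant-stars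
weight functions (`HullPort.twoStars_update`) with fewer fractional pairs.  Affinity `E_w(v) = (1−c)E_{w₀}(v) + cE_{w₁}(v)` and the induction
hypothesis on ONE side give the two admissible single-pair steps
   S1(f): `(1−c)·M_{w₀} + c·E_{w₁}(v) ≤ M_w`,      S2(f): `(1−c)·E_{w₀}(v) + c·M_{w₁} ≤ M_w`
(`M` = maximal port lightness, here any upper bound `m ≥ 0` of the port lightnesses).  SHARP-ANY: some fractional pair satisfies S1 or S2.
* `HullPort.outsiderStep_of_sharpAny` : SHARP-ANY → the OUTSIDER STEP of `dc_of_outsiderStepAll`;  `HullPort.dc_of_sharpAny` : SHARP-ANY → (DC).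
WHY (memo `run/shared/lean/prim/prim-hp-3/HULLPORT-REF-gen6.md` §12–§13): the star-pair-only law SHARP fails on 22 exact glued instances of the ttrl census
(deleting a shared fractional star pair un-glues a port), on all of which a pair of `K` satisfies S1/S2; seat census of SHARP-ANY: 0 failures (≈ 30 000 pairs incl.
glued ports and near-integral `K`).  A failure of SHARP-ANY would mean that no single deletion–contraction step can carry the (DC) induction.
-/

noncomputable section

namespace Summit.CriticalPhenomena.PercolationContinuityZ3.Theorems

open MeasureTheory Set Literature.Probability.LatticeModels Literature.Probability.Percolation
open scoped Classical BigOperators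

variable {n : ℕ}

namespace HullPort

/-- Changing the weight of a pair of NONZERO weight keeps the two-pendant-stars shape (the pair is a star pair to a relay or avoids both observers).
[folklore] -/
theorem twoStars_update (w : Sym2 (Fin n) → unitInterval) (A : Finset (Fin n)) (o₁ o₂ : Fin n) (f : Sym2 (Fin n)) (t : unitInterval)
    (hw12 : w s(o₁, o₂) = 0) (hpend₁ : ∀ u, w s(o₁, u) ≠ 0 → u ∈ A) (hpend₂ : ∀ u, w s(o₂, u) ≠ 0 → u ∈ A) (hf : w f ≠ 0) :
    (Function.update w f t) s(o₁, o₂) = 0 ∧ (∀ u, (Function.update w f t) s(o₁, u) ≠ 0 → u ∈ A) ∧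
      (∀ u, (Function.update w f t) s(o₂, u) ≠ 0 → u ∈ A) := by
  have hne : s(o₁, o₂) ≠ f := fun h => hf (h ▸ hw12)
  refine ⟨by rw [Function.update_of_ne hne]; exact hw12, ?_, ?_⟩
  · intro u hu
    by_cases h : s(o₁, u) = f
    · exact hpend₁ u (h ▸ hf)
    · rw [Function.update_of_ne h] at hu; exact hpend₁ u hu
  · intro u hu
    by_cases h : s(o₂, u) = f
    · exact hpend₂ u (h ▸ hf)
    · rw [Function.update_of_ne h] at hu; exact hpend₂ u hu

/-- **The OUTSIDER STEP from SHARP-ANY.** [this work] -/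
theorem outsiderStep_of_sharpAny (A : Finset (Fin n)) (o₁ o₂ : Fin n) (j : ℕ)
    (hSharp : (∀ w : Sym2 (Fin n) → unitInterval, w s(o₁, o₂) = 0 → (∀ u, w s(o₁, u) ≠ 0 → u ∈ A) → (∀ u, w s(o₂, u) ≠ 0 → u ∈ A) →
      ∀ v ∈ A, w s(o₁, v) = 0 → w s(o₂, v) = 0 →
      (∃ a ∈ A, (w s(o₁, a) ≠ 0 ∧ w s(o₁, a) ≠ 1) ∨ (w s(o₂, a) ≠ 0 ∧ w s(o₂, a) ≠ 1)) →
      ∃ f : Sym2 (Fin n), w f ≠ 0 ∧ w f ≠ 1 ∧ ∃ p ∈ A, (w s(o₁, p) ≠ 0 ∨ w s(o₂, p) ≠ 0) ∧ ∃ m : ℝ, 0 ≤ m ∧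
        (((∀ p' ∈ A, ((Function.update w f 0) s(o₁, p') ≠ 0 ∨ (Function.update w f 0) s(o₂, p') ≠ 0) →
            (prodBernoulli (Function.update w f 0)).real {ω : BondConfig (Fin n) | (A.filter fun z => ω ∈ openConn p' z).card ≤ j} ≤ m) ∧
          (1 - (w f : ℝ)) * m + (w f : ℝ) *
            ((prodBernoulli (Function.update w f 1)).real {ω : BondConfig (Fin n) | (∀ x ∈ ({o₁, o₂} : Finset (Fin n)), ω ∉ openConn v x) ∧
              1 ≤ (A.filter fun z => ∃ x ∈ ({o₁, o₂} : Finset (Fin n)), ω ∈ openConn x z).card ∧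
              (A.filter fun z => ∃ x ∈ ({o₁, o₂} : Finset (Fin n)), ω ∈ openConn x z).card ≤ j} +
            (prodBernoulli (Function.update w f 1)).real {ω : BondConfig (Fin n) | (∃ x ∈ ({o₁, o₂} : Finset (Fin n)), ω ∈ openConn v x) ∧
              (A.filter fun z => ω ∈ openConn v z).card ≤ j}) ≤
          (prodBernoulli w).real {ω : BondConfig (Fin n) | (A.filter fun z => ω ∈ openConn p z).card ≤ j}) ∨
         ((∀ p' ∈ A, ((Function.update w f 1) s(o₁, p') ≠ 0 ∨ (Function.update w f 1) s(o₂, p') ≠ 0) →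
            (prodBernoulli (Function.update w f 1)).real {ω : BondConfig (Fin n) | (A.filter fun z => ω ∈ openConn p' z).card ≤ j} ≤ m) ∧
          (1 - (w f : ℝ)) *
            ((prodBernoulli (Function.update w f 0)).real {ω : BondConfig (Fin n) | (∀ x ∈ ({o₁, o₂} : Finset (Fin n)), ω ∉ openConn v x) ∧
              1 ≤ (A.filter fun z => ∃ x ∈ ({o₁, o₂} : Finset (Fin n)), ω ∈ openConn x z).card ∧
              (A.filter fun z => ∃ x ∈ ({o₁, o₂} : Finset (Fin n)), ω ∈ openConn x z).card ≤ j} +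
            (prodBernoulli (Function.update w f 0)).real {ω : BondConfig (Fin n) | (∃ x ∈ ({o₁, o₂} : Finset (Fin n)), ω ∈ openConn v x) ∧
              (A.filter fun z => ω ∈ openConn v z).card ≤ j}) + (w f : ℝ) * m ≤
          (prodBernoulli w).real {ω : BondConfig (Fin n) | (A.filter fun z => ω ∈ openConn p z).card ≤ j})))) :
    (∀ w : Sym2 (Fin n) → unitInterval,
      o₁ ∉ A → o₂ ∉ A → o₁ ≠ o₂ → w s(o₁, o₂) = 0 → (∀ u, w s(o₁, u) ≠ 0 → u ∈ A) → (∀ u, w s(o₂, u) ≠ 0 → u ∈ A) →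
      (∀ w' : Sym2 (Fin n) → unitInterval, w' s(o₁, o₂) = 0 → (∀ u, w' s(o₁, u) ≠ 0 → u ∈ A) → (∀ u, w' s(o₂, u) ≠ 0 → u ∈ A) →
        (Finset.univ.filter fun e : Sym2 (Fin n) => w' e ≠ 0 ∧ w' e ≠ 1).card <
          (Finset.univ.filter fun e : Sym2 (Fin n) => w e ≠ 0 ∧ w e ≠ 1).card →
        (∀ v ∈ A, ∃ p ∈ A, (((prodBernoulli w').real {ω : BondConfig (Fin n) | (∀ x ∈ ({o₁, o₂} : Finset (Fin n)), ω ∉ openConn v x) ∧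
              1 ≤ (A.filter fun z => ∃ x ∈ ({o₁, o₂} : Finset (Fin n)), ω ∈ openConn x z).card ∧
              (A.filter fun z => ∃ x ∈ ({o₁, o₂} : Finset (Fin n)), ω ∈ openConn x z).card ≤ j} +
            (prodBernoulli w').real {ω : BondConfig (Fin n) | (∃ x ∈ ({o₁, o₂} : Finset (Fin n)), ω ∈ openConn v x) ∧
              (A.filter fun z => ω ∈ openConn v z).card ≤ j}) = 0 ∨ w' s(o₁, p) ≠ 0 ∨ w' s(o₂, p) ≠ 0) ∧
          ((prodBernoulli w').real {ω : BondConfig (Fin n) | (∀ x ∈ ({o₁, o₂} : Finset (Fin n)), ω ∉ openConn v x) ∧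
              1 ≤ (A.filter fun z => ∃ x ∈ ({o₁, o₂} : Finset (Fin n)), ω ∈ openConn x z).card ∧
              (A.filter fun z => ∃ x ∈ ({o₁, o₂} : Finset (Fin n)), ω ∈ openConn x z).card ≤ j} +
            (prodBernoulli w').real {ω : BondConfig (Fin n) | (∃ x ∈ ({o₁, o₂} : Finset (Fin n)), ω ∈ openConn v x) ∧
              (A.filter fun z => ω ∈ openConn v z).card ≤ j}) ≤
          (prodBernoulli w').real {ω : BondConfig (Fin n) | (A.filter fun z => ω ∈ openConn p z).card ≤ j})) →
      ∀ v ∈ A, w s(o₁, v) = 0 → w s(o₂, v) = 0 →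
      (∃ a ∈ A, (w s(o₁, a) ≠ 0 ∧ w s(o₁, a) ≠ 1) ∨ (w s(o₂, a) ≠ 0 ∧ w s(o₂, a) ≠ 1)) →
      ∃ p ∈ A, (((prodBernoulli w).real {ω : BondConfig (Fin n) | (∀ x ∈ ({o₁, o₂} : Finset (Fin n)), ω ∉ openConn v x) ∧
              1 ≤ (A.filter fun z => ∃ x ∈ ({o₁, o₂} : Finset (Fin n)), ω ∈ openConn x z).card ∧
              (A.filter fun z => ∃ x ∈ ({o₁, o₂} : Finset (Fin n)), ω ∈ openConn x z).card ≤ j} +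
            (prodBernoulli w).real {ω : BondConfig (Fin n) | (∃ x ∈ ({o₁, o₂} : Finset (Fin n)), ω ∈ openConn v x) ∧
              (A.filter fun z => ω ∈ openConn v z).card ≤ j}) = 0 ∨ w s(o₁, p) ≠ 0 ∨ w s(o₂, p) ≠ 0) ∧
        ((prodBernoulli w).real {ω : BondConfig (Fin n) | (∀ x ∈ ({o₁, o₂} : Finset (Fin n)), ω ∉ openConn v x) ∧
              1 ≤ (A.filter fun z => ∃ x ∈ ({o₁, o₂} : Finset (Fin n)), ω ∈ openConn x z).card ∧
              (A.filter fun z => ∃ x ∈ ({o₁, o₂} : Finset (Fin n)), ω ∈ openConn x z).card ≤ j} +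
            (prodBernoulli w).real {ω : BondConfig (Fin n) | (∃ x ∈ ({o₁, o₂} : Finset (Fin n)), ω ∈ openConn v x) ∧
              (A.filter fun z => ω ∈ openConn v z).card ≤ j}) ≤
        (prodBernoulli w).real {ω : BondConfig (Fin n) | (A.filter fun z => ω ∈ openConn p z).card ≤ j}) := by
  intro w ho₁A ho₂A h12 hw12 hpend₁ hpend₂ IH v hvA hv₁ hv₂ hex
  obtain ⟨f, hf0, hf1, p, hpA, hpport, m, hm0, halt⟩ := hSharp w hw12 hpend₁ hpend₂ v hvA hv₁ hv₂ hex
  -- affinity of the two E-events in the coordinate `f`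
  set Sb : Set (BondConfig (Fin n)) := {ω | (∀ x ∈ ({o₁, o₂} : Finset (Fin n)), ω ∉ openConn v x) ∧
        1 ≤ (A.filter fun z => ∃ x ∈ ({o₁, o₂} : Finset (Fin n)), ω ∈ openConn x z).card ∧
        (A.filter fun z => ∃ x ∈ ({o₁, o₂} : Finset (Fin n)), ω ∈ openConn x z).card ≤ j} with hSb
  set Sa : Set (BondConfig (Fin n)) := {ω | (∃ x ∈ ({o₁, o₂} : Finset (Fin n)), ω ∈ openConn v x) ∧
        (A.filter fun z => ω ∈ openConn v z).card ≤ j} with hSa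
  have hwe : Function.update w f (w f) = w := Function.update_eq_self f w
  have aff : ∀ S : Set (BondConfig (Fin n)),
      (prodBernoulli w).real S = (1 - (w f : ℝ)) * (prodBernoulli (Function.update w f 0)).real S +
        (w f : ℝ) * (prodBernoulli (Function.update w f 1)).real S := by
    intro S
    have h := real_update_affine w f (w f) S
    rw [hwe] at h
    exact h
  have hc0 : 0 ≤ (w f : ℝ) := (w f).2.1
  have hc1 : (w f : ℝ) ≤ 1 := (w f).2.2
  have hE0nn : 0 ≤ (prodBernoulli (Function.update w f 0)).real Sb + (prodBernoulli (Function.update w f 0)).real Sa :=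
    add_nonneg measureReal_nonneg measureReal_nonneg
  have hE1nn : 0 ≤ (prodBernoulli (Function.update w f 1)).real Sb + (prodBernoulli (Function.update w f 1)).real Sa :=
    add_nonneg measureReal_nonneg measureReal_nonneg
  refine ⟨p, hpA, Or.inr hpport, ?_⟩
  rw [aff Sb, aff Sa]
  rcases halt with ⟨hmax, hle⟩ | ⟨hmax, hle⟩
  · -- S1: induction hypothesis on the deleted side
    obtain ⟨h012, hp₁', hp₂'⟩ := twoStars_update w A o₁ o₂ f 0 hw12 hpend₁ hpend₂ hf0
    obtain ⟨p₀, hp₀A, hp₀_or, hp₀_le⟩ :=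
      IH (Function.update w f 0) h012 hp₁' hp₂' (fractionalPairs_erase_lt w f hf0 hf1) v hvA
    have h0 : (prodBernoulli (Function.update w f 0)).real Sb + (prodBernoulli (Function.update w f 0)).real Sa ≤ m := by
      rcases hp₀_or with h0 | h | h
      · have : (prodBernoulli (Function.update w f 0)).real Sb + (prodBernoulli (Function.update w f 0)).real Sa = 0 := h0
        rw [this]; exact hm0
      · exact hp₀_le.trans (hmax p₀ hp₀A (Or.inl h))
      · exact hp₀_le.trans (hmax p₀ hp₀A (Or.inr h))
    have hA : (1 - (w f : ℝ)) * ((prodBernoulli (Function.update w f 0)).real Sb + (prodBernoulli (Function.update w f 0)).real Sa) ≤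
        (1 - (w f : ℝ)) * m := mul_le_mul_of_nonneg_left h0 (by linarith)
    nlinarith [hA, hle, hc0, hE1nn]
  · -- S2: induction hypothesis on the glued side
    obtain ⟨h112, hp₁', hp₂'⟩ := twoStars_update w A o₁ o₂ f 1 hw12 hpend₁ hpend₂ hf0
    obtain ⟨p₁, hp₁A, hp₁_or, hp₁_le⟩ :=
      IH (Function.update w f 1) h112 hp₁' hp₂' (fractionalPairs_glue_lt w f hf0 hf1) v hvA
    have h1 : (prodBernoulli (Function.update w f 1)).real Sb + (prodBernoulli (Function.update w f 1)).real Sa ≤ m := by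
      rcases hp₁_or with h0 | h | h
      · have : (prodBernoulli (Function.update w f 1)).real Sb + (prodBernoulli (Function.update w f 1)).real Sa = 0 := h0
        rw [this]; exact hm0
      · exact hp₁_le.trans (hmax p₁ hp₁A (Or.inl h))
      · exact hp₁_le.trans (hmax p₁ hp₁A (Or.inr h))
    have hB : (w f : ℝ) * ((prodBernoulli (Function.update w f 1)).real Sb + (prodBernoulli (Function.update w f 1)).real Sa) ≤
        (w f : ℝ) * m := mul_le_mul_of_nonneg_left h1 hc0
    nlinarith [hB, hle, hc1, hE0nn]

/-- **(DC) from SHARP-ANY.** [this work] -/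
theorem dc_of_sharpAny (A : Finset (Fin n)) (o₁ o₂ : Fin n) (j : ℕ)
    (hSharp : (∀ w : Sym2 (Fin n) → unitInterval, w s(o₁, o₂) = 0 → (∀ u, w s(o₁, u) ≠ 0 → u ∈ A) → (∀ u, w s(o₂, u) ≠ 0 → u ∈ A) →
      ∀ v ∈ A, w s(o₁, v) = 0 → w s(o₂, v) = 0 →
      (∃ a ∈ A, (w s(o₁, a) ≠ 0 ∧ w s(o₁, a) ≠ 1) ∨ (w s(o₂, a) ≠ 0 ∧ w s(o₂, a) ≠ 1)) →
      ∃ f : Sym2 (Fin n), w f ≠ 0 ∧ w f ≠ 1 ∧ ∃ p ∈ A, (w s(o₁, p) ≠ 0 ∨ w s(o₂, p) ≠ 0) ∧ ∃ m : ℝ, 0 ≤ m ∧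
        (((∀ p' ∈ A, ((Function.update w f 0) s(o₁, p') ≠ 0 ∨ (Function.update w f 0) s(o₂, p') ≠ 0) →
            (prodBernoulli (Function.update w f 0)).real {ω : BondConfig (Fin n) | (A.filter fun z => ω ∈ openConn p' z).card ≤ j} ≤ m) ∧
          (1 - (w f : ℝ)) * m + (w f : ℝ) *
            ((prodBernoulli (Function.update w f 1)).real {ω : BondConfig (Fin n) | (∀ x ∈ ({o₁, o₂} : Finset (Fin n)), ω ∉ openConn v x) ∧
              1 ≤ (A.filter fun z => ∃ x ∈ ({o₁, o₂} : Finset (Fin n)), ω ∈ openConn x z).card ∧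
              (A.filter fun z => ∃ x ∈ ({o₁, o₂} : Finset (Fin n)), ω ∈ openConn x z).card ≤ j} +
            (prodBernoulli (Function.update w f 1)).real {ω : BondConfig (Fin n) | (∃ x ∈ ({o₁, o₂} : Finset (Fin n)), ω ∈ openConn v x) ∧
              (A.filter fun z => ω ∈ openConn v z).card ≤ j}) ≤
          (prodBernoulli w).real {ω : BondConfig (Fin n) | (A.filter fun z => ω ∈ openConn p z).card ≤ j}) ∨
         ((∀ p' ∈ A, ((Function.update w f 1) s(o₁, p') ≠ 0 ∨ (Function.update w f 1) s(o₂, p') ≠ 0) →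
            (prodBernoulli (Function.update w f 1)).real {ω : BondConfig (Fin n) | (A.filter fun z => ω ∈ openConn p' z).card ≤ j} ≤ m) ∧
          (1 - (w f : ℝ)) *
            ((prodBernoulli (Function.update w f 0)).real {ω : BondConfig (Fin n) | (∀ x ∈ ({o₁, o₂} : Finset (Fin n)), ω ∉ openConn v x) ∧
              1 ≤ (A.filter fun z => ∃ x ∈ ({o₁, o₂} : Finset (Fin n)), ω ∈ openConn x z).card ∧
              (A.filter fun z => ∃ x ∈ ({o₁, o₂} : Finset (Fin n)), ω ∈ openConn x z).card ≤ j} +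
            (prodBernoulli (Function.update w f 0)).real {ω : BondConfig (Fin n) | (∃ x ∈ ({o₁, o₂} : Finset (Fin n)), ω ∈ openConn v x) ∧
              (A.filter fun z => ω ∈ openConn v z).card ≤ j}) + (w f : ℝ) * m ≤
          (prodBernoulli w).real {ω : BondConfig (Fin n) | (A.filter fun z => ω ∈ openConn p z).card ≤ j}))))
    (w : Sym2 (Fin n) → unitInterval)
    (ho₁A : o₁ ∉ A) (ho₂A : o₂ ∉ A) (h12 : o₁ ≠ o₂) (hw12 : w s(o₁, o₂) = 0)
    (hpend₁ : ∀ u, w s(o₁, u) ≠ 0 → u ∈ A) (hpend₂ : ∀ u, w s(o₂, u) ≠ 0 → u ∈ A) :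
    (∀ v ∈ A, ∃ p ∈ A, (((prodBernoulli w).real {ω : BondConfig (Fin n) | (∀ x ∈ ({o₁, o₂} : Finset (Fin n)), ω ∉ openConn v x) ∧
              1 ≤ (A.filter fun z => ∃ x ∈ ({o₁, o₂} : Finset (Fin n)), ω ∈ openConn x z).card ∧
              (A.filter fun z => ∃ x ∈ ({o₁, o₂} : Finset (Fin n)), ω ∈ openConn x z).card ≤ j} +
            (prodBernoulli w).real {ω : BondConfig (Fin n) | (∃ x ∈ ({o₁, o₂} : Finset (Fin n)), ω ∈ openConn v x) ∧
              (A.filter fun z => ω ∈ openConn v z).card ≤ j}) = 0 ∨ w s(o₁, p) ≠ 0 ∨ w s(o₂, p) ≠ 0) ∧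
          ((prodBernoulli w).real {ω : BondConfig (Fin n) | (∀ x ∈ ({o₁, o₂} : Finset (Fin n)), ω ∉ openConn v x) ∧
              1 ≤ (A.filter fun z => ∃ x ∈ ({o₁, o₂} : Finset (Fin n)), ω ∈ openConn x z).card ∧
              (A.filter fun z => ∃ x ∈ ({o₁, o₂} : Finset (Fin n)), ω ∈ openConn x z).card ≤ j} +
            (prodBernoulli w).real {ω : BondConfig (Fin n) | (∃ x ∈ ({o₁, o₂} : Finset (Fin n)), ω ∈ openConn v x) ∧
              (A.filter fun z => ω ∈ openConn v z).card ≤ j}) ≤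
          (prodBernoulli w).real {ω : BondConfig (Fin n) | (A.filter fun z => ω ∈ openConn p z).card ≤ j}) :=
  dc_of_outsiderStepAll A o₁ o₂ j (outsiderStep_of_sharpAny A o₁ o₂ j hSharp) w ho₁A ho₂A h12 hw12 hpend₁ hpend₂

end HullPort

end Summit.CriticalPhenomena.PercolationContinuityZ3.Theorems

end
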